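import Literature.Topology.FourManifolds.LatticeFormsEichlerCriterion
import HarnessLib

/-!
# Commutators of Eichler transvections: `[t(e,−sf₁), t(e₁,u)] = t(e, su − s(u²/2)e₁)`, and with a third hyperbolic plane
# `t(e,e₁)` is a product of three commutators (Gritsenko–Hulek–Sankaran, *J. Algebra* 322 (2009) §4.1)

Trunk T-4MAN vocabulary (`LatticeFormsTransvections.lean`: `E(e,a,q) = B.eichlerTransvection e a q`, GHS's
`t(e,a) = E(e,a,½(a,a))`, the composition law (t3) `eichlerTransvection_comp` and naturality (t4)
`IsometryEquiv.map_eichlerTransvection_apply`; `LatticeFormsEichlerCriterion.lean`: `TwoHyperbolicPairs`). Written for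
lane `lit-hodgefound` (Track 2 foundations; prover seat `lit-hodgefound-p18`, gen 49, row g49-#5). THEOREMS ONLY — no
definition, no named fact, no instance, no notation.

## Source, verbatim (held text `paper:arxiv-0810.1614`, §4.1 "Proof of Theorem 1.7", p. 8)

"According to Proposition 3.3 (ii), the group `E(L)` is generated by all `t(e,u)` and `t(f,v)` where `u, v ∈ L₁`. We
prove that these generators are the products of commutators in `E(L_p)` […] Now we consider `p = 2`. Let
`L = U ⊕ U₁ ⊕ L₀`, with `U = ℤe ⊕ ℤf` and `U₁ = ℤe₁ ⊕ ℤf₁`. For any `u` orthogonal to `e` and `f₁` we have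
`t(e₁,u)(e) = e`, `t(e₁,u)(f₁) = f₁ + u − ½(u,u)e₁`. Therefore for any `s ∈ ℚ₂^×` we have
`[t(e,−sf₁), t(e₁,u)] = t(e, su − s(u²/2)e₁)`. Using the same formula for `v` and `−(u+v)` we obtain the following
representation `t(e, s(u,v)e₁) = [t(e,−sf₁), t(e₁,u)]·[t(e,−sf₁), t(e₁,v)]·[t(e,−sf₁), t(e₁,−u−v)]`. Since
`rank₂(L) ≥ 6`, we can find `u, v ∈ L₀ ⊗ ℤ₂` such that `(u,v) ∈ ℤ₂^×`. Therefore taking `s = (u,v)⁻¹` we obtain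
`t(e,e₁)` as the product of three commutators in `E(L ⊗ ℤ₂)`."

## Contents (all proved) and reading notes

Conventions: GHS's `e, f, e₁, f₁` are the tree's `y, x, y₁, x₁` (`TwoHyperbolicPairs B x y x₁ y₁`), `[a,b] = aba⁻¹b⁻¹`
with maps composed right to left, and everything is over `ℤ` (`s q : ℤ`, `(u,u) = 2q`).

* §1 `t(e,−sf₁)` moves `e₁` to `e₁ + se` and fixes `u` (`eichlerTransvection_y_neg_smul_x₁_apply_y₁`), hence (t4)
  `t(e,−sf₁) t(e₁,u) t(e,−sf₁)⁻¹ = t(e₁ + se, u)` (`…_conj_…`), and the **commutator formula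
  `[t(e,−sf₁), t(e₁,u)] = t(e, su − sq e₁)`** with the tree's parameter `½(su − sq e₁)² = s²q`
  (`eichlerTransvection_commutator`), for any `u ⊥ e, e₁, f₁` with `(u,u) = 2q` (orthogonality to `f` is not needed).
* §2 The three-commutator product, computed EXACTLY with (t3): for `u, v ⊥ U, U₁`,
  `[t(e,−sf₁),t(e₁,u)]·[t(e,−sf₁),t(e₁,v)]·[t(e,−sf₁),t(e₁,−u−v)] = t(e, −s(q_u + q_v + q_{u+v}) e₁)` with
  `q_{u+v} = q_u + q_v + (u,v)`, i.e. `= t(e, −s((u,u) + (v,v) + (u,v)) e₁)` (`eichlerTransvection_three_commutators`) —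
  the printed right-hand side `t(e, s(u,v)e₁)` keeps only the cross term (harmless for the printed use over `ℤ₂`, where
  `u, v` are then adjusted); over `ℤ` the exact form gives **`t(e,e₁)` as a product of three commutators of unimodular
  transvections as soon as `L₀` contains a third hyperbolic pair `e₂, f₂`**: `u = e₂`, `v = f₂`, `s = −1`
  (`eichlerTransvection_y_y₁_eq_three_commutators`: `t(e,e₁) = [t(e,f₁),t(e₁,e₂)]·[t(e,f₁),t(e₁,f₂)]·[t(e,f₁),t(e₁,−e₂−f₂)]`).
-/

noncomputable section

open Module
open LinearMap (BilinForm)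
open LinearMap.BilinForm (IsometryEquiv)

namespace Literature.Topology.FourManifolds

section Commutator

variable {W : Type*} [AddCommGroup W] {B : BilinForm ℤ W} {y x₁ y₁ u : W}

/-- `t(e,−sf₁)(e₁) = e₁ + se` (`(f₁,e₁) = 1`, `e ⊥ e₁`): in the tree's letters `E(y, −s x₁, 0) y₁ = y₁ + s y`.
[cite: GritsenkoHulekSankaran2009, §4.1 (p = 2 step)] -/
theorem eichlerTransvection_y_neg_smul_x₁_apply_y₁ (hyy₁ : B y y₁ = 0) (hx₁y₁ : B x₁ y₁ = 1) (s : ℤ) :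
    B.eichlerTransvection y (-(s • x₁)) 0 y₁ = y₁ + s • y := by
  rw [LinearMap.BilinForm.eichlerTransvection_apply, hyy₁, map_neg, map_smul, LinearMap.neg_apply,
    LinearMap.smul_apply, hx₁y₁, smul_eq_mul, mul_one, zero_smul, add_zero, mul_zero, zero_smul, sub_zero, neg_smul,
    sub_neg_eq_add]

/-- `t(e,−sf₁)` fixes every `u ⊥ e, f₁`: `E(y, −s x₁, 0) u = u`. [cite: GritsenkoHulekSankaran2009, §4.1 (p = 2 step)] -/
theorem eichlerTransvection_y_neg_smul_x₁_apply_of_ortho (hyu : B y u = 0) (hx₁u : B x₁ u = 0) (s : ℤ) :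
    B.eichlerTransvection y (-(s • x₁)) 0 u = u := by
  rw [LinearMap.BilinForm.eichlerTransvection_apply, hyu, map_neg, map_smul, LinearMap.neg_apply,
    LinearMap.smul_apply, hx₁u, smul_zero, neg_zero, zero_smul, zero_smul, mul_zero, zero_smul, add_zero, sub_zero,
    sub_zero]

/-- **(t4) for this pair: `t(e,−sf₁) t(e₁,u) t(e,−sf₁)⁻¹ = t(e₁ + se, u)`** (pointwise; `B` symmetric, `e, f₁` isotropic
and orthogonal, `(f₁,e₁) = 1`, `e ⊥ e₁`, `u ⊥ e, f₁`). [cite: GritsenkoHulekSankaran2009, §4.1 and §3.1 (t4)] -/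
theorem eichlerTransvection_conj_eichlerTransvection_y₁ (hB : B.IsSymm) (hyy : B y y = 0) (hyx₁ : B y x₁ = 0)
    (hx₁x₁ : B x₁ x₁ = 0) (hyy₁ : B y y₁ = 0) (hx₁y₁ : B x₁ y₁ = 1) (hyu : B y u = 0) (hx₁u : B x₁ u = 0) (s q : ℤ)
    (w : W) :
    B.eichlerTransvection y (-(s • x₁)) 0 (B.eichlerTransvection y₁ u q (B.eichlerTransvection y (s • x₁) 0 w)) =
      B.eichlerTransvection (y₁ + s • y) u q w := by
  have hya : B y (-(s • x₁)) = 0 := by rw [map_neg, map_smul, hyx₁, smul_zero, neg_zero]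
  have haa : B (-(s • x₁)) (-(s • x₁)) = 0 + 0 := by simp [hx₁x₁]
  set A := LinearMap.BilinForm.IsometryEquiv.eichlerTransvection B hB y (-(s • x₁)) 0 hyy hya haa with hA
  have hAw : ∀ w', A w' = B.eichlerTransvection y (-(s • x₁)) 0 w' := fun w' ↦ rfl
  have hAsymm : ∀ w', A.symm w' = B.eichlerTransvection y (s • x₁) 0 w' := fun w' ↦ by
    rw [hA, LinearMap.BilinForm.IsometryEquiv.eichlerTransvection_symm_apply, neg_neg]
  rw [← hAsymm, ← hAw, LinearMap.BilinForm.IsometryEquiv.map_eichlerTransvection_apply, hAw, hAw,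
    eichlerTransvection_y_neg_smul_x₁_apply_y₁ hyy₁ hx₁y₁, eichlerTransvection_y_neg_smul_x₁_apply_of_ortho hyu hx₁u]
  congr 1
  exact A.toLinearEquiv.apply_symm_apply w

/-- **The commutator formula `[t(e,−sf₁), t(e₁,u)] = t(e, su − s(u²/2)e₁)`** (`[a,b] = aba⁻¹b⁻¹`), as an identity
of linear maps: `E(y,−sx₁,0) ∘ E(y₁,u,q) ∘ E(y,sx₁,0) ∘ E(y₁,−u,q) = E(y, su − (sq)y₁, s²q)` for `B` symmetric, two
orthogonal isotropic pairs `e ⊥ f₁`, `(f₁,e₁) = 1`, `e ⊥ e₁`, `e₁` isotropic, and `u ⊥ e, e₁, f₁` with `(u,u) = 2q`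
(`½(su − sq e₁)² = s²q`). Proof: (t4) turns the first three factors into `t(e₁ + se, u)`, then expand.
[cite: GritsenkoHulekSankaran2009, §4.1 ("[t(e,−sf₁), t(e₁,u)] = t(e, su − s(u²/2)e₁)")] -/
theorem eichlerTransvection_commutator (hB : B.IsSymm) (hyy : B y y = 0) (hyx₁ : B y x₁ = 0) (hx₁x₁ : B x₁ x₁ = 0)
    (hyy₁ : B y y₁ = 0) (hy₁y₁ : B y₁ y₁ = 0) (hx₁y₁ : B x₁ y₁ = 1) (hyu : B y u = 0) (hx₁u : B x₁ u = 0)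
    (hy₁u : B y₁ u = 0) {s q : ℤ} (huu : B u u = q + q) :
    B.eichlerTransvection y (-(s • x₁)) 0 ∘ₗ B.eichlerTransvection y₁ u q ∘ₗ B.eichlerTransvection y (s • x₁) 0 ∘ₗ
        B.eichlerTransvection y₁ (-u) q =
      B.eichlerTransvection y (s • u - (s * q) • y₁) (s * s * q) := by
  refine LinearMap.ext fun v ↦ ?_
  rw [LinearMap.comp_apply, LinearMap.comp_apply, LinearMap.comp_apply,
    eichlerTransvection_conj_eichlerTransvection_y₁ hB hyy hyx₁ hx₁x₁ hyy₁ hx₁y₁ hyu hx₁u s q]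
  have huy₁ : B u y₁ = 0 := by rw [hB.eq, hy₁u]
  simp only [LinearMap.BilinForm.eichlerTransvection_apply, map_add, map_sub, map_smul, map_neg, LinearMap.add_apply,
    LinearMap.sub_apply, LinearMap.smul_apply, LinearMap.neg_apply, smul_eq_mul, hyy₁, hy₁y₁, hyu, hy₁u, huy₁, huu]
  module

end Commutator

/-! ### §2 Three commutators: `t(e,e₁)` from a third hyperbolic plane -/

section Three

variable {W : Type*} [AddCommGroup W] {B : BilinForm ℤ W} {x y x₁ y₁ u v : W}

/-- **The product of the three commutators, exactly**: for `u, v ⊥ e, e₁, f₁` with `(u,u) = 2q_u`, `(v,v) = 2q_v`,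
`(u,v) = c`, the product `[t(e,−sf₁),t(e₁,u)]·[t(e,−sf₁),t(e₁,v)]·[t(e,−sf₁),t(e₁,−u−v)]` of the three values of the
commutator formula is `t(e, su − sq_u e₁) t(e, sv − sq_v e₁) t(e, −s(u+v) − sq_{u+v} e₁) = t(e, −s(q_u+q_v+q_{u+v})e₁)`,
`q_{u+v} = q_u + q_v + c` — with the tree's parameters:
`E(y, su − (sq_u)y₁, s²q_u) ∘ E(y, sv − (sq_v)y₁, s²q_v) ∘ E(y, −s(u+v) − (s q_{u+v})y₁, s²q_{u+v}) =
E(y, −(s(q_u+q_v+q_{u+v})) y₁, 0)` ((t3) twice; the printed `t(e, s(u,v)e₁)` is the cross term of this).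
[cite: GritsenkoHulekSankaran2009, §4.1 ("Using the same formula for v and −(u+v) …")] -/
theorem eichlerTransvection_three_commutators (hB : B.IsSymm) (hyy : B y y = 0) (hyy₁ : B y y₁ = 0)
    (hy₁y₁ : B y₁ y₁ = 0) (hyu : B y u = 0) (hyv : B y v = 0) (hy₁u : B y₁ u = 0) (hy₁v : B y₁ v = 0) {s qu qv c : ℤ}
    (huu : B u u = qu + qu) (hvv : B v v = qv + qv) (huv : B u v = c) :
    B.eichlerTransvection y (s • u - (s * qu) • y₁) (s * s * qu) ∘ₗ
        B.eichlerTransvection y (s • v - (s * qv) • y₁) (s * s * qv) ∘ₗ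
        B.eichlerTransvection y (s • (-u - v) - (s * (qu + qv + c)) • y₁) (s * s * (qu + qv + c)) =
      B.eichlerTransvection y (-((s * (qu + qv + (qu + qv + c))) • y₁)) 0 := by
  have hy₁y : B y₁ y = 0 := by rw [hB.eq, hyy₁]
  have huy₁ : B u y₁ = 0 := by rw [hB.eq, hy₁u]
  have hvy₁ : B v y₁ = 0 := by rw [hB.eq, hy₁v]
  have hvu : B v u = c := by rw [hB.eq, huv]
  have h1 : B y (s • u - (s * qu) • y₁) = 0 := by simp [hyu, hyy₁]
  have h2 : B y (s • v - (s * qv) • y₁) = 0 := by simp [hyv, hyy₁]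
  have h3 : B y (s • (-u - v) - (s * (qu + qv + c)) • y₁) = 0 := by simp [hyu, hyv, hyy₁]
  rw [LinearMap.BilinForm.eichlerTransvection_comp B hB hyy h2 h3, LinearMap.BilinForm.eichlerTransvection_comp B hB hyy h1
    (by rw [map_add, h2, h3, add_zero])]
  have hvec : s • u - (s * qu) • y₁ + (s • v - (s * qv) • y₁ + (s • (-u - v) - (s * (qu + qv + c)) • y₁)) =
      -((s * (qu + qv + (qu + qv + c))) • y₁) := by module
  have hpar : s * s * qu + (s * s * qv + s * s * (qu + qv + c) +
      B (s • v - (s * qv) • y₁) (s • (-u - v) - (s * (qu + qv + c)) • y₁)) +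
      B (s • u - (s * qu) • y₁) (s • v - (s * qv) • y₁ + (s • (-u - v) - (s * (qu + qv + c)) • y₁)) = 0 := by
    simp only [map_add, map_sub, map_smul, map_neg, LinearMap.sub_apply, LinearMap.smul_apply, smul_eq_mul, huu, hvv,
      huv, hvu, hy₁u, huy₁, hy₁v, hvy₁, hy₁y₁]
    ring
  rw [hvec, hpar]

/-- **`t(e,e₁)` is a product of three commutators of unimodular transvections when there is a third hyperbolic pair**
`e₂, f₂ ⊥ U, U₁` (`u = e₂`, `v = f₂`, `s = −1` in the formulas above; `q_u = q_v = 0`, `(u,v) = 1`, `q_{u+v} = 1`):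
`t(e,e₁) = [t(e,f₁), t(e₁,e₂)] · [t(e,f₁), t(e₁,f₂)] · [t(e,f₁), t(e₁,−e₂−f₂)]`, in the tree's letters
`E(y,y₁,0) = (E(y,x₁,0) E(y₁,x₂,0) E(y,−x₁,0) E(y₁,−x₂,0)) ∘ (E(y,x₁,0) E(y₁,y₂,0) E(y,−x₁,0) E(y₁,−y₂,0)) ∘
(E(y,x₁,0) E(y₁,−x₂−y₂,1) E(y,−x₁,0) E(y₁,x₂+y₂,1))` — the integral case behind the printed "taking `s = (u,v)⁻¹` we
obtain `t(e,e₁)` as the product of three commutators". [cite: GritsenkoHulekSankaran2009, §4.1] -/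
theorem eichlerTransvection_y_y₁_eq_three_commutators {x₂ y₂ : W} (h₁ : TwoHyperbolicPairs B x y x₁ y₁)
    (h₂ : TwoHyperbolicPairs B x y x₂ y₂) (h₁₂ : TwoHyperbolicPairs B x₁ y₁ x₂ y₂) :
    B.eichlerTransvection y y₁ 0 =
      (B.eichlerTransvection y (-((-1 : ℤ) • x₁)) 0 ∘ₗ B.eichlerTransvection y₁ x₂ 0 ∘ₗ
          B.eichlerTransvection y ((-1 : ℤ) • x₁) 0 ∘ₗ B.eichlerTransvection y₁ (-x₂) 0) ∘ₗ
      (B.eichlerTransvection y (-((-1 : ℤ) • x₁)) 0 ∘ₗ B.eichlerTransvection y₁ y₂ 0 ∘ₗ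
          B.eichlerTransvection y ((-1 : ℤ) • x₁) 0 ∘ₗ B.eichlerTransvection y₁ (-y₂) 0) ∘ₗ
      (B.eichlerTransvection y (-((-1 : ℤ) • x₁)) 0 ∘ₗ B.eichlerTransvection y₁ (-x₂ - y₂) 1 ∘ₗ
          B.eichlerTransvection y ((-1 : ℤ) • x₁) 0 ∘ₗ B.eichlerTransvection y₁ (-(-x₂ - y₂)) 1) := by
  have hB := h₁.isSymm
  have hx₂y₂ : B (-x₂ - y₂) (-x₂ - y₂) = 1 + 1 := by
    simp only [map_sub, map_neg, LinearMap.sub_apply, LinearMap.neg_apply, h₂.x₁x₁, h₂.y₁y₁, h₂.x₁y₁, h₂.y₁x₁]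
    ring
  rw [eichlerTransvection_commutator hB h₁.yy h₁.yx₁ h₁.x₁x₁ h₁.yy₁ h₁.y₁y₁ h₁.x₁y₁ h₂.yx₁ h₁₂.xx₁ h₁₂.yx₁
      (s := -1) (q := 0) (by rw [h₂.x₁x₁, add_zero]),
    eichlerTransvection_commutator hB h₁.yy h₁.yx₁ h₁.x₁x₁ h₁.yy₁ h₁.y₁y₁ h₁.x₁y₁ h₂.yy₁ h₁₂.xy₁ h₁₂.yy₁
      (s := -1) (q := 0) (by rw [h₂.y₁y₁, add_zero]),
    eichlerTransvection_commutator hB h₁.yy h₁.yx₁ h₁.x₁x₁ h₁.yy₁ h₁.y₁y₁ h₁.x₁y₁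
      (by rw [map_sub, map_neg, h₂.yx₁, h₂.yy₁, neg_zero, sub_zero])
      (by rw [map_sub, map_neg, h₁₂.xx₁, h₁₂.xy₁, neg_zero, sub_zero])
      (by rw [map_sub, map_neg, h₁₂.yx₁, h₁₂.yy₁, neg_zero, sub_zero]) (s := -1) (q := 1) hx₂y₂,
    show ((-1 : ℤ) * 1 : ℤ) = -1 * (0 + 0 + 1) by ring, show ((-1 : ℤ) * -1 * 1 : ℤ) = -1 * -1 * (0 + 0 + 1) by ring,
    eichlerTransvection_three_commutators hB h₁.yy h₁.yy₁ h₁.y₁y₁ h₂.yx₁ h₂.yy₁ h₁₂.yx₁ h₁₂.yy₁ (s := -1) (qu := 0)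
      (qv := 0) (c := 1) (by rw [h₂.x₁x₁, add_zero]) (by rw [h₂.y₁y₁, add_zero]) h₂.x₁y₁]
  congr 1
  module

end Three

end Literature.Topology.FourManifolds

end
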